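import Literature.Geometry.Lorentzian.HyperboloidalDefectFoliation
import Literature.Geometry.Lorentzian.LateChartDilation
import Literature.Geometry.Lorentzian.BoostedKerrDilation
import Literature.Geometry.Lorentzian.KerrSchildCoord
import HarnessLib

/-!
# Dilation degeneracy of the LE-weighted leaf deviation `leafDev`

Negative-lane helper for the crux `KillingDefectSpacetimeBound.RecurrentKerrEraWithBudgets`
(item `stmt-FinalStateConjecture-18633`; it asserts NO decl of the route file).

`Spacetime.leafDev M₀ a₀ Ψ χ k τ` (`Literature.Geometry.Lorentzian.HyperboloidalDefectFoliation`)
is an infimum over re-chartings `Φ` modelled on `Kerr.hypStarBackground M a` with the Kerr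
parameters `(M, a)` FREE (`0 < M`, `|a| ≤ χ M`) and with the local-energy weight `(1 + ‖y‖)⁻¹`
evaluated in `Φ`'s OWN coordinates. The Kerr–Schild family is scale covariant
(`g_{λM,λa}(y) = g_{M,a}(λ⁻¹ y)` componentwise, `Kerr.bilin_smul_smul`), so precomposing an
admissible re-charting `Φ₀` (parameters `(M, a)`) with the dilation `y ↦ λ⁻¹ y` gives an admissible
re-charting with parameters `(λM, λa)` (`IsLeafRechart` is dilation invariant) whose measured set
sits at Kerr–Schild radius `> λM`, where the weight is `< (1 + λM)⁻¹`, while the `m`-th coordinate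
derivatives of its deviation at `y` are at most those of `λ⁻² (Φ₀^* g − g_{M,a}) − (1 − λ⁻²) g_{M,a}`
at `λ⁻¹ y` (chain rule, `λ ≥ 1`). Hence, for every `λ ≥ 1` (`leafDev_le_dilate`),

  `leafDev ≤ λ⁻² · W₀ + (1 + λM)⁻¹ · K`,

`W₀` the LE-weighted `Cᵏ` size of the deviation of `Φ₀` and `K` the unweighted `Cᵏ` size of the
components `g_{M,a}` over the measured set. Letting `λ → ∞`: `leafDev = 0` as soon as ONE
admissible re-charting has `W₀ < ∞` and `K < ∞` (`leafDev_eq_zero_of_finite`), and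
`leafDev ∈ {0, ∞}` given the textbook boundedness of the `Cᵏ` components of `g_{M,a}` on
`{r > M}` (`leafDev_eq_zero_or_top`). Consequently a clause `leafDev … ≤ ENNReal.ofReal ε` carries
no Kerr-closeness content beyond `leafDev < ∞`; the recurrence clause of
`RecurrentKerrEraWithBudgets` and the smallness hypotheses `leafDev ≤ δ` of the cruxes K1–K3 are
decorative. Repair (planner): evaluate the weight in the reference chart `Ψ`
(`(1 + ‖spatial (Ψ⁻¹ (Φ y))‖)⁻¹`), or require radius comparability of `Φ` against `Ψ` on the band.
-/

open Set Filter Function Topology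
open scoped Manifold ContDiff ENNReal

noncomputable section

namespace Summit.FinalStateConjecture.FinalStateConjecture.Theorems.RecurrentKerrEraWithBudgets.Negative

open Literature.Geometry.Lorentzian

universe u

/-! ### The Kerr–Schild region, the Kerr–Schild metric and the LE weight under dilations -/

/-- `λ⁻¹ y ∈ {r(a,·) > M} ↔ y ∈ {r(λa,·) > λM}` (`r(λa, λz) = λ r(a, z)`, `Kerr.radius_smul`).
[folklore] -/
theorem inv_smul_mem_region_iff {lam : ℝ} (hlam : 0 < lam) (M a : ℝ) (y : E4) :
    lam⁻¹ • y ∈ Kerr.region a M ↔ y ∈ Kerr.region (lam * a) (lam * M) := by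
  have hrad : Kerr.radius (lam * a) y = lam * Kerr.radius a (lam⁻¹ • y) := by
    have h := Kerr.radius_smul hlam a (lam⁻¹ • y)
    rwa [smul_inv_smul₀ hlam.ne'] at h
  have hmax : max (lam * M) 0 = lam * max M 0 := by
    rw [mul_max_of_nonneg M 0 hlam.le, mul_zero]
  rw [Kerr.mem_region, Kerr.mem_region, hrad, hmax]
  exact ((strictMono_mul_left_of_pos hlam).lt_iff_lt).symm

/-- Scale covariance of the Kerr–Schild components: `g_{λM,λa}(y) = g_{M,a}(λ⁻¹ y)`
(`Kerr.bilin_smul_smul`). [folklore] -/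
theorem bilin_dilate {lam : ℝ} (hlam : 0 < lam) (M a : ℝ) (y : E4) :
    Kerr.bilin (lam * M) (lam * a) y = Kerr.bilin M a (lam⁻¹ • y) := by
  have h := Kerr.bilin_smul_smul hlam M a (lam⁻¹ • y)
  rwa [smul_inv_smul₀ hlam.ne'] at h

/-- The LE weight decreases under dilation by `λ ≥ 1`: `(1 + λ‖z⃗‖)⁻¹ ≤ (1 + ‖z⃗‖)⁻¹`. [folklore] -/
theorem leWeight_smul_le {lam : ℝ} (hlam : 1 ≤ lam) (z : E4) :
    leWeight (lam • z) ≤ leWeight z := by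
  unfold leWeight
  refine ENNReal.ofReal_le_ofReal (inv_anti₀ (by positivity) ?_)
  rw [map_smul, norm_smul, Real.norm_eq_abs, abs_of_pos (one_pos.trans_le hlam)]
  nlinarith [norm_nonneg (E4.spatial z)]

/-- On the dilate of `{r(a,·) > M}` the LE weight is at most `(1 + λM)⁻¹`
(`‖(λz)⃗‖ = λ‖z⃗‖ ≥ λ r(a,z) > λM`, `Kerr.radius_le_spatialNorm`). [folklore] -/
theorem leWeight_smul_le_inv {lam M a : ℝ} (hlam : 1 ≤ lam) (hM : 0 < M) {z : E4}
    (hz : z ∈ Kerr.region a M) : leWeight (lam • z) ≤ ENNReal.ofReal (1 + lam * M)⁻¹ := by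
  unfold leWeight
  have hlam0 : 0 < lam := one_pos.trans_le hlam
  refine ENNReal.ofReal_le_ofReal (inv_anti₀ (add_pos one_pos (mul_pos hlam0 hM)) ?_)
  rw [map_smul, norm_smul, Real.norm_eq_abs, abs_of_pos hlam0]
  have h1 : M < Kerr.radius a z := Kerr.lt_radius_of_mem_region hz
  have h2 : Kerr.radius a z ≤ ‖E4.spatial z‖ := Kerr.radius_le_spatialNorm a z
  nlinarith

/-! ### A pointwise bound for `s f + t g` -/

section Generic

variable {F G : Type*} [NormedAddCommGroup F] [NormedSpace ℝ F] [NormedAddCommGroup G]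
  [NormedSpace ℝ G]

/-- `‖Dᵐ(s f + t g)(x)‖ ≤ |s| ‖Dᵐf(x)‖ + |t| ‖Dᵐg(x)‖` for `f`, `g` of class `Cᵐ` at `x`. [folklore] -/
theorem norm_iteratedFDeriv_smul_add_smul_le {f g : F → G} {x : F} {m : ℕ}
    (hf : ContDiffAt ℝ m f x) (hg : ContDiffAt ℝ m g x) (s t : ℝ) :
    ‖iteratedFDeriv ℝ m (fun y ↦ s • f y + t • g y) x‖ ≤
      |s| * ‖iteratedFDeriv ℝ m f x‖ + |t| * ‖iteratedFDeriv ℝ m g x‖ := by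
  rw [fun_iteratedFDeriv_add_apply (hf.const_smul s) (hg.const_smul t),
    iteratedFDeriv_const_smul_apply' hf, iteratedFDeriv_const_smul_apply' hg]
  refine (norm_add_le _ _).trans (le_of_eq ?_)
  rw [norm_smul, norm_smul, Real.norm_eq_abs, Real.norm_eq_abs]

end Generic

/-! ### Deviations in the constantly rescaled spacetime -/

/-- In `(M, s g)` the chart deviation is `s Φ^* g − g₀` (definitional). [folklore] -/
theorem deviation_constSmul (𝓢 : Spacetime.{u} 4) {s : ℝ} (hs : 0 < s) (B : ModelBackground)
    (Φ : B.domain → 𝓢.carrier) (x : B.domain) :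
    (𝓢.constSmul s hs).deviation B Φ x = s • 𝓢.chartMetric B Φ x - B.bilin x.1 := by
  ext v w
  rfl

/-- **Pointwise derivative bound for the deviation in `(M, s g)` against `B♯(M, a)`**: at a point
`z` of the (open) region `{r > M}`, where `s Φ^*g − g_{M,a} = s (Φ^*g − g_{M,a}) + (s − 1) g_{M,a}`
near `z`, `‖Dᵐ(s Φ^*g − g_{M,a})(z)‖ ≤ |s| ‖Dᵐ(Φ^*g − g_{M,a})(z)‖ + |s − 1| ‖Dᵐ g_{M,a}(z)‖`
(the chart metric being smooth on the region). [folklore] -/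
theorem norm_iteratedFDeriv_deviationExtend_constSmul_le {𝓢 : Spacetime.{u} 4} {M a : ℝ}
    {Φ : (Kerr.hypStarBackground M a).domain → 𝓢.carrier}
    (hΦ : ContDiffOn ℝ ∞ (𝓢.chartMetricExtend (Kerr.hypStarBackground M a) Φ)
      ((Kerr.hypStarBackground M a).domain : Set E4))
    {s : ℝ} (hs : 0 < s) {z : E4} (hz : z ∈ Kerr.region a M) (m : ℕ) :
    ‖iteratedFDeriv ℝ m ((𝓢.constSmul s hs).deviationExtend (Kerr.hypStarBackground M a) Φ) z‖ ≤
      |s| * ‖iteratedFDeriv ℝ m (𝓢.deviationExtend (Kerr.hypStarBackground M a) Φ) z‖ +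
        |s - 1| * ‖iteratedFDeriv ℝ m (Kerr.bilin M a) z‖ := by
  have hU : (Kerr.region a M : Set E4) ∈ 𝓝 z := (Kerr.region a M).isOpen.mem_nhds hz
  have hbil : ContDiffAt ℝ m (Kerr.bilin M a) z :=
    Kerr.contDiffAt_bilin M a (Kerr.radius_pos_of_mem_region hz)
  have hmtop : (m : WithTop ℕ∞) ≤ ((⊤ : ℕ∞) : WithTop ℕ∞) := by exact_mod_cast le_top
  have hCM : ContDiffAt ℝ m (𝓢.chartMetricExtend (Kerr.hypStarBackground M a) Φ) z :=
    ((hΦ z hz).contDiffAt hU).of_le hmtop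
  have hdevEq : 𝓢.deviationExtend (Kerr.hypStarBackground M a) Φ =ᶠ[𝓝 z]
      fun y ↦ 𝓢.chartMetricExtend (Kerr.hypStarBackground M a) Φ y - Kerr.bilin M a y := by
    filter_upwards [hU] with y hy
    obtain ⟨x, rfl⟩ : ∃ x : (Kerr.hypStarBackground M a).domain, (x : E4) = y := ⟨⟨y, hy⟩, rfl⟩
    exact 𝓢.deviationExtend_coe_eq (Kerr.hypStarBackground M a) Φ x
  have hdev : ContDiffAt ℝ m (𝓢.deviationExtend (Kerr.hypStarBackground M a) Φ) z :=
    (hCM.sub hbil).congr_of_eventuallyEq hdevEq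
  have hGEq : (𝓢.constSmul s hs).deviationExtend (Kerr.hypStarBackground M a) Φ =ᶠ[𝓝 z]
      fun y ↦ s • 𝓢.deviationExtend (Kerr.hypStarBackground M a) Φ y +
        (s - 1) • Kerr.bilin M a y := by
    filter_upwards [hU] with y hy
    obtain ⟨x, rfl⟩ : ∃ x : (Kerr.hypStarBackground M a).domain, (x : E4) = y := ⟨⟨y, hy⟩, rfl⟩
    rw [Spacetime.deviationExtend_coe, Spacetime.deviationExtend_coe, deviation_constSmul,
      Spacetime.deviation_eq_chartMetric_sub]
    change s • 𝓢.chartMetric (Kerr.hypStarBackground M a) Φ x - Kerr.bilin M a x =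
      s • (𝓢.chartMetric (Kerr.hypStarBackground M a) Φ x - Kerr.bilin M a x) +
        (s - 1) • Kerr.bilin M a x
    module
  rw [(hGEq.iteratedFDeriv ℝ m).eq_of_nhds]
  exact norm_iteratedFDeriv_smul_add_smul_le hdev hbil s (s - 1)

/-! ### The dilation bound and its consequences -/

/-- **Dilation bound for the leaf deviation.** If `Φ₀` is an admissible re-charting of the band
with parameters `(M, a)` in range, then for every `λ ≥ 1`
`leafDev ≤ λ⁻² · W₀ + (1 + λM)⁻¹ · K`, where `W₀` is the LE-weighted `Cᵏ` size of the deviation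
`Φ₀^* g − g_{M,a}` and `K` the `Cᵏ` size of `g_{M,a}` over the measured set `Φ₀⁻¹(Ψ(band))`
(test re-charting `Φ₀ ∘ (λ⁻¹ ·)` with parameters `(λM, λa)`; the weight is read in the dilated
coordinates). [folklore] -/
theorem leafDev_le_dilate {𝓢 : Spacetime.{u} 4} {M₀ a₀ : ℝ}
    {Ψ : (Kerr.hypStarBackground M₀ a₀).domain → 𝓢.carrier} {χ : ℝ} {k : ℕ} {τ M a : ℝ}
    {Φ₀ : (Kerr.hypStarBackground M a).domain → 𝓢.carrier}
    (hΦ₀ : 𝓢.IsLeafRechart M₀ a₀ Ψ τ M a Φ₀) (hM : 0 < M) (ha : |a| ≤ χ * M)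
    {lam : ℝ} (hlam : 1 ≤ lam) :
    𝓢.leafDev M₀ a₀ Ψ χ k τ ≤
      ENNReal.ofReal (lam⁻¹ ^ 2) *
          leSupCkENorm (Subtype.val '' (Φ₀ ⁻¹' (Ψ '' (Kerr.hypStarBackground M₀ a₀).timeBand
            (Icc τ (τ + 1))))) k (𝓢.deviationExtend (Kerr.hypStarBackground M a) Φ₀) +
        ENNReal.ofReal (1 + lam * M)⁻¹ *
          supCkENorm (Subtype.val '' (Φ₀ ⁻¹' (Ψ '' (Kerr.hypStarBackground M₀ a₀).timeBand
            (Icc τ (τ + 1))))) k (Kerr.bilin M a) := by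
  have hlam0 : 0 < lam := one_pos.trans_le hlam
  set c : ℝ := lam⁻¹ with hc_def
  have hc : 0 < c := inv_pos.2 hlam0
  have hc1 : c ≤ 1 := inv_le_one_of_one_le₀ hlam
  -- the dilation `δ y = λ⁻¹ y : B♯(λM, λa) → B♯(M, a)`
  obtain ⟨δ, hδ⟩ : ∃ δ : (Kerr.hypStarBackground (lam * M) (lam * a)).domain →
      (Kerr.hypStarBackground M a).domain, ∀ y, (δ y : E4) = c • (y : E4) :=
    ⟨fun y ↦ ⟨c • (y : E4), (inv_smul_mem_region_iff hlam0 M a y).2 y.2⟩, fun _ ↦ rfl⟩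
  have hdom : ∀ y : E4, y ∈ (Kerr.hypStarBackground (lam * M) (lam * a)).domain ↔
      c • y ∈ (Kerr.hypStarBackground M a).domain := fun y ↦
    (inv_smul_mem_region_iff hlam0 M a y).symm
  have hbil : ∀ y : E4, (Kerr.hypStarBackground (lam * M) (lam * a)).bilin y =
      (Kerr.hypStarBackground M a).bilin (c • y) := fun y ↦ bilin_dilate hlam0 M a y
  have hsurj : Surjective δ := surjective_dilate hc.ne' hδ hdom
  have hinj : Injective δ := fun y₁ y₂ h ↦ Subtype.ext (smul_right_injective E4 hc.ne' (by
    have h' := congrArg Subtype.val h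
    rwa [hδ, hδ] at h'))
  -- `Φ₀ ∘ δ` is an admissible re-charting with parameters `(λM, λa)`
  have hΦ : 𝓢.IsLeafRechart M₀ a₀ Ψ τ (lam * M) (lam * a) (Φ₀ ∘ δ) := by
    refine ⟨hΦ₀.contMDiff.comp (contMDiff_dilate hδ), ?_, ?_, ?_⟩
    · -- on the domain the chart metric of `Φ₀ ∘ δ` is `c² (Φ₀^* g)(c ·)` (chain rule)
      have hsm : ContDiffOn ℝ ∞
          (fun y : E4 ↦ c ^ 2 • 𝓢.chartMetricExtend (Kerr.hypStarBackground M a) Φ₀ (c • y))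
          ((Kerr.hypStarBackground (lam * M) (lam * a)).domain : Set E4) :=
        (hΦ₀.contDiffOn.const_smul (c ^ 2)).comp (contDiff_const_smul c).contDiffOn
          fun y hy ↦ (hdom y).1 hy
      refine hsm.congr fun y hy ↦ ?_
      obtain ⟨x, rfl⟩ : ∃ x : (Kerr.hypStarBackground (lam * M) (lam * a)).domain, (x : E4) = y :=
        ⟨⟨y, hy⟩, rfl⟩
      have hδd : MDifferentiableAt 𝓘(ℝ, E4) 𝓘(ℝ, E4) δ x :=
        (contMDiff_dilate hδ).mdifferentiableAt (by simp)
      have hΦd : MDifferentiableAt 𝓘(ℝ, E4) (𝓡 4) Φ₀ (δ x) :=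
        hΦ₀.contMDiff.mdifferentiableAt (by simp)
      have hcomp : ∀ v : TangentSpace 𝓘(ℝ, E4) (δ x), mfderiv 𝓘(ℝ, E4) (𝓡 4) (Φ₀ ∘ δ) x v =
          c • mfderiv 𝓘(ℝ, E4) (𝓡 4) Φ₀ (δ x) v := fun v ↦ by
        rw [mfderiv_comp x hΦd hδd]
        show mfderiv 𝓘(ℝ, E4) (𝓡 4) Φ₀ (δ x) (mfderiv 𝓘(ℝ, E4) 𝓘(ℝ, E4) δ x v) = _
        rw [show mfderiv 𝓘(ℝ, E4) 𝓘(ℝ, E4) δ x v = c • v from mfderiv_dilate_apply hδ x v,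
          map_smul]
      rw [Spacetime.chartMetricExtend_coe, ← hδ, Spacetime.chartMetricExtend_coe]
      ext v w
      change 𝓢.metric.val (Φ₀ (δ x)) (mfderiv 𝓘(ℝ, E4) (𝓡 4) (Φ₀ ∘ δ) x v)
          (mfderiv 𝓘(ℝ, E4) (𝓡 4) (Φ₀ ∘ δ) x w) =
        c ^ 2 * 𝓢.metric.val (Φ₀ (δ x)) (mfderiv 𝓘(ℝ, E4) (𝓡 4) Φ₀ (δ x) v)
          (mfderiv 𝓘(ℝ, E4) (𝓡 4) Φ₀ (δ x) w)
      rw [hcomp v, hcomp w]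
      simp only [map_smul, FunLike.coe_smul, Pi.smul_apply, smul_eq_mul]
      ring
    · intro y₁ hy₁ y₂ hy₂ h
      exact hinj (hΦ₀.injOn hy₁ hy₂ h)
    · rw [hsurj.range_comp Φ₀]
      exact hΦ₀.covers
  -- parameters in range
  have hM' : 0 < lam * M := mul_pos hlam0 hM
  have ha' : |lam * a| ≤ χ * (lam * M) := by
    rw [abs_mul, abs_of_pos hlam0, mul_left_comm]
    exact mul_le_mul_of_nonneg_left ha hlam0.le
  refine (Spacetime.leafDev_le M₀ a₀ Ψ χ k τ hM' ha' hΦ).trans ?_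
  rw [𝓢.deviationExtend_comp_dilate hc hδ hdom hbil hΦ₀.contMDiff]
  refine iSup₂_le fun m hm ↦ iSup₂_le fun y hy ↦ ?_
  obtain ⟨x', hx', rfl⟩ := hy
  -- the corresponding point `z = λ⁻¹ y` of the measured set of `Φ₀`
  have hz : c • (x' : E4) ∈ Subtype.val '' (Φ₀ ⁻¹' (Ψ ''
      (Kerr.hypStarBackground M₀ a₀).timeBand (Icc τ (τ + 1)))) := ⟨δ x', hx', hδ x'⟩
  have hzU : c • (x' : E4) ∈ Kerr.region a M := by rw [← hδ]; exact (δ x').2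
  -- pointwise derivative bound
  have h1 := norm_iteratedFDeriv_comp_smul_le
    ((𝓢.constSmul (c ^ 2) (pow_pos hc 2)).deviationExtend (Kerr.hypStarBackground M a) Φ₀)
    hc.ne' m (x' : E4)
  have h2 := norm_iteratedFDeriv_deviationExtend_constSmul_le hΦ₀.contDiffOn (pow_pos hc 2) hzU m
  have hcm : |c| ^ m ≤ 1 := pow_le_one₀ (abs_nonneg c) (by rwa [abs_of_pos hc])
  have hs1 : |c ^ 2| = c ^ 2 := abs_of_pos (pow_pos hc 2)
  have hc2 : c ^ 2 ≤ 1 := pow_le_one₀ hc.le hc1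
  have hs2 : |c ^ 2 - 1| ≤ 1 := by
    rw [abs_sub_comm, abs_of_nonneg (sub_nonneg.2 hc2)]
    nlinarith [pow_pos hc 2]
  have h3 : ‖iteratedFDeriv ℝ m
        (fun y ↦ (𝓢.constSmul (c ^ 2) (pow_pos hc 2)).deviationExtend (Kerr.hypStarBackground M a) Φ₀ (c • y)) (x' : E4)‖ ≤
      c ^ 2 * ‖iteratedFDeriv ℝ m (𝓢.deviationExtend (Kerr.hypStarBackground M a) Φ₀) (c • (x' : E4))‖ +
        ‖iteratedFDeriv ℝ m (Kerr.bilin M a) (c • (x' : E4))‖ := by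
    refine h1.trans ((mul_le_of_le_one_left (norm_nonneg _) hcm).trans (h2.trans ?_))
    rw [hs1]
    gcongr
    exact mul_le_of_le_one_left (norm_nonneg _) hs2
  -- weights at `y = λ z`
  have hyz : lam • (c • (x' : E4)) = (x' : E4) := smul_inv_smul₀ hlam0.ne' _
  have hw1 : leWeight (x' : E4) ≤ leWeight (c • (x' : E4)) := by
    have h := leWeight_smul_le hlam (c • (x' : E4))
    rwa [hyz] at h
  have hw2 : leWeight (x' : E4) ≤ ENNReal.ofReal (1 + lam * M)⁻¹ := by
    have h := leWeight_smul_le_inv hlam hM hzU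
    rwa [hyz] at h
  calc leWeight (x' : E4) * ‖iteratedFDeriv ℝ m
          (fun y ↦ (𝓢.constSmul (c ^ 2) (pow_pos hc 2)).deviationExtend (Kerr.hypStarBackground M a) Φ₀ (c • y)) (x' : E4)‖ₑ
      ≤ leWeight (x' : E4) *
          (ENNReal.ofReal (c ^ 2) * ‖iteratedFDeriv ℝ m (𝓢.deviationExtend (Kerr.hypStarBackground M a) Φ₀) (c • (x' : E4))‖ₑ +
            ‖iteratedFDeriv ℝ m (Kerr.bilin M a) (c • (x' : E4))‖ₑ) := by
        gcongr
        rw [← ofReal_norm, ← ofReal_norm, ← ofReal_norm, ← ENNReal.ofReal_mul (pow_pos hc 2).le,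
          ← ENNReal.ofReal_add (by positivity) (norm_nonneg _)]
        exact ENNReal.ofReal_le_ofReal h3
    _ = ENNReal.ofReal (c ^ 2) * (leWeight (x' : E4) *
            ‖iteratedFDeriv ℝ m (𝓢.deviationExtend (Kerr.hypStarBackground M a) Φ₀) (c • (x' : E4))‖ₑ) +
          leWeight (x' : E4) * ‖iteratedFDeriv ℝ m (Kerr.bilin M a) (c • (x' : E4))‖ₑ := by
        ring
    _ ≤ ENNReal.ofReal (c ^ 2) * (leWeight (c • (x' : E4)) *
            ‖iteratedFDeriv ℝ m (𝓢.deviationExtend (Kerr.hypStarBackground M a) Φ₀) (c • (x' : E4))‖ₑ) +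
          ENNReal.ofReal (1 + lam * M)⁻¹ *
            ‖iteratedFDeriv ℝ m (Kerr.bilin M a) (c • (x' : E4))‖ₑ := by
        gcongr
    _ ≤ _ := by
        gcongr
        · exact le_iSup₂_of_le m hm (le_iSup₂_of_le _ hz le_rfl)
        · exact enorm_iteratedFDeriv_le_supCkENorm hm hz _

/-- **The leaf deviation vanishes as soon as it is witnessed finitely**: if one admissible
re-charting `Φ₀` with parameters in range has finite LE-weighted `Cᵏ` deviation `W₀ < ∞` and the
components `g_{M,a}` have finite `Cᵏ` size `K < ∞` over its measured set, then `leafDev = 0`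
(`λ → ∞` in `leafDev_le_dilate`). [folklore] -/
theorem leafDev_eq_zero_of_finite {𝓢 : Spacetime.{u} 4} {M₀ a₀ : ℝ}
    {Ψ : (Kerr.hypStarBackground M₀ a₀).domain → 𝓢.carrier} {χ : ℝ} {k : ℕ} {τ M a : ℝ}
    {Φ₀ : (Kerr.hypStarBackground M a).domain → 𝓢.carrier}
    (hΦ₀ : 𝓢.IsLeafRechart M₀ a₀ Ψ τ M a Φ₀) (hM : 0 < M) (ha : |a| ≤ χ * M)
    (hW : leSupCkENorm (Subtype.val '' (Φ₀ ⁻¹' (Ψ '' (Kerr.hypStarBackground M₀ a₀).timeBand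
      (Icc τ (τ + 1))))) k (𝓢.deviationExtend (Kerr.hypStarBackground M a) Φ₀) ≠ ⊤)
    (hK : supCkENorm (Subtype.val '' (Φ₀ ⁻¹' (Ψ '' (Kerr.hypStarBackground M₀ a₀).timeBand
      (Icc τ (τ + 1))))) k (Kerr.bilin M a) ≠ ⊤) :
    𝓢.leafDev M₀ a₀ Ψ χ k τ = 0 := by
  set W := leSupCkENorm (Subtype.val '' (Φ₀ ⁻¹' (Ψ '' (Kerr.hypStarBackground M₀ a₀).timeBand
      (Icc τ (τ + 1))))) k (𝓢.deviationExtend (Kerr.hypStarBackground M a) Φ₀) with hWdef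
  set K := supCkENorm (Subtype.val '' (Φ₀ ⁻¹' (Ψ '' (Kerr.hypStarBackground M₀ a₀).timeBand
      (Icc τ (τ + 1))))) k (Kerr.bilin M a) with hKdef
  have h1 : Tendsto (fun lam : ℝ ↦ ENNReal.ofReal (lam⁻¹ ^ 2)) atTop (𝓝 0) := by
    have h := (tendsto_inv_atTop_zero : Tendsto (fun r : ℝ ↦ r⁻¹) atTop (𝓝 0)).pow 2
    rw [zero_pow two_ne_zero] at h
    simpa using ENNReal.tendsto_ofReal h
  have h2 : Tendsto (fun lam : ℝ ↦ ENNReal.ofReal (1 + lam * M)⁻¹) atTop (𝓝 0) := by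
    have h : Tendsto (fun lam : ℝ ↦ 1 + lam * M) atTop atTop :=
      tendsto_atTop_add_const_left _ _ (tendsto_id.atTop_mul_const hM)
    simpa using ENNReal.tendsto_ofReal (tendsto_inv_atTop_zero.comp h)
  have hT : Tendsto (fun lam : ℝ ↦ ENNReal.ofReal (lam⁻¹ ^ 2) * W + ENNReal.ofReal (1 + lam * M)⁻¹ * K)
      atTop (𝓝 0) := by
    have h := (ENNReal.Tendsto.mul_const h1 (Or.inr hW)).add (ENNReal.Tendsto.mul_const h2 (Or.inr hK))
    simpa using h
  exact le_antisymm (ge_of_tendsto hT (eventually_atTop.2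
    ⟨1, fun lam hlam ↦ leafDev_le_dilate hΦ₀ hM ha hlam⟩)) (zero_le)

/-- **Dichotomy `leafDev ∈ {0, ∞}`** given bounded `Cᵏ` components of the sub-extremal Kerr–Schild
metrics on `{r > M}` (a textbook property of `g_{M,a} = η + 2H ℓ ⊗ ℓ`, `|a| < M`: `H`, `ℓ` and all
their coordinate derivatives are bounded on `{r > M}`; stated here as a hypothesis on the spin
range `|a| ≤ χM` actually used): either no admissible re-charting has finite weighted deviation
(`leafDev = ∞`) or `leafDev = 0`. In particular `leafDev ≤ ENNReal.ofReal ε` is equivalent to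
`leafDev < ∞` for every `ε ≥ 0`. [folklore] -/
theorem leafDev_eq_zero_or_top {𝓢 : Spacetime.{u} 4} {M₀ a₀ : ℝ}
    {Ψ : (Kerr.hypStarBackground M₀ a₀).domain → 𝓢.carrier} {χ : ℝ} {k : ℕ} {τ : ℝ}
    (hKerr : ∀ M a : ℝ, 0 < M → |a| ≤ χ * M →
      supCkENorm (Kerr.region a M : Set E4) k (Kerr.bilin M a) < ⊤) :
    𝓢.leafDev M₀ a₀ Ψ χ k τ = 0 ∨ 𝓢.leafDev M₀ a₀ Ψ χ k τ = ⊤ := by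
  refine or_iff_not_imp_right.2 fun htop ↦ ?_
  have hlt : 𝓢.leafDev M₀ a₀ Ψ χ k τ < ⊤ := lt_top_iff_ne_top.2 htop
  simp only [Spacetime.leafDev, iInf_lt_iff] at hlt
  obtain ⟨M, a, ⟨hM, ha⟩, Φ₀, hΦ₀, hW⟩ := hlt
  refine leafDev_eq_zero_of_finite hΦ₀ hM ha hW.ne ?_
  refine ((supCkENorm_mono ?_ k _).trans_lt (hKerr M a hM ha)).ne
  rintro _ ⟨x, -, rfl⟩
  exact x.2

/-- The recurrence clause of `RecurrentKerrEraWithBudgets` degenerates accordingly: under the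
same textbook hypothesis, `(∀ ε > 0, ∃ᶠ τ, leafDev … τ ≤ ENNReal.ofReal ε)` is equivalent to
`∃ᶠ τ, leafDev … τ < ∞` ("frequently SOME admissible re-charting has finite weighted deviation"),
a statement with no Kerr-closeness content. [folklore] -/
theorem recurrence_iff_frequently_finite {𝓢 : Spacetime.{u} 4} {M₀ a₀ : ℝ}
    {Ψ : (Kerr.hypStarBackground M₀ a₀).domain → 𝓢.carrier} {χ : ℝ} {k : ℕ}
    (hKerr : ∀ M a : ℝ, 0 < M → |a| ≤ χ * M →
      supCkENorm (Kerr.region a M : Set E4) k (Kerr.bilin M a) < ⊤) :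
    (∀ ε : ℝ, 0 < ε → ∃ᶠ τ in atTop, 𝓢.leafDev M₀ a₀ Ψ χ k τ ≤ ENNReal.ofReal ε) ↔
      ∃ᶠ τ in atTop, 𝓢.leafDev M₀ a₀ Ψ χ k τ < ⊤ := by
  constructor
  · intro h
    exact (h 1 one_pos).mono fun τ hτ ↦ hτ.trans_lt ENNReal.ofReal_lt_top
  · intro h ε _
    refine h.mono fun τ hτ ↦ ?_
    rcases leafDev_eq_zero_or_top (M₀ := M₀) (a₀ := a₀) (Ψ := Ψ) (τ := τ) hKerr with h0 | htop
    · rw [h0]; exact zero_le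
    · exact absurd htop hτ.ne

end Summit.FinalStateConjecture.FinalStateConjecture.Theorems.RecurrentKerrEraWithBudgets.Negative

end
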